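import Mathlib
import Summits.KontsevichZagierPeriods.Zeta5Search.DenomLaw.LawA5Shifted
import HarnessLib

/-!
# ζ(5) search — THEOREM L5⁺ as ONE Boolean guard (`lawA5ShiftedGuard`) with its licence, for per-cell kernel evaluation

Cell `pub-zeta5` (HONEST FRAMING: systematic search; no irrationality claim unless certified), track «DENOM-LAW», seat `denom-prover-d1` gen 10
(ATTEMPT-10 §9).  The hypotheses of THEOREM L5⁺ (`SecondOrder.lawA5_shifted`, file `DenomLaw/LawA5Shifted.lean`) that concern ONE parameter vector — the
`LawA4` class clauses (`RecordWindowsA4.LawA4Classes`), the shape clause (T4) (`SecondResidueLaw.ShapeClause`) and the emptiness of the two deepest layers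
(multipole `E ≥ −M+2`, single-pole `ν ≥ −M+2`) — packed into ONE decidable Boolean `lawA5ShiftedGuard b p M T` (to be evaluated for `b` AND `b + e_j`), and
the licence `lawA5_shifted_of_guard`: both guards `= true`, `10 ≤ M` even, `T` a palindrome, `p(M − 4) ≤ 2d(b) + 1`, window ⇒ `9 − 2M ≤ v_p(Cas_j(b))`.  Kernel sanity
on one cell of the first-period sampler that no landed rung reaches (`b = (28; 12,10,8,7,7,4,3)`, `p = 11`, ⌊d/p⌋ = 3, frame `(10, [−5,−5])`: law = v = −11 =
9 − 2·10, casLB = −13).  `p`-adic valuations of the cell's own rationals; nothing about ζ(5); records in print UNMOVED.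
-/

open Finset

namespace Summit.KontsevichZagierPeriods.Zeta5Search.SecondOrder

open Summit.KontsevichZagierPeriods.Zeta5Search.CasoratianValuation (InPolytope shift casoratian)
open Summit.KontsevichZagierPeriods.Zeta5Search.WedgeDictionary (dOf)
open Summit.KontsevichZagierPeriods.Zeta5Search.ClusterValuation
open Summit.KontsevichZagierPeriods.Zeta5Search.RecordWindowsA4 (LawA4Classes)
open Summit.KontsevichZagierPeriods.Zeta5Search.SecondResidueLaw (ShapeClause isRaiseN)

/-- **L5⁺ GUARD (one vector)**: the `LawA4` class clauses, the shape clause (T4), and the two deepest layers empty, for `b` at `p` in the frame `(M, T)`. -/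
def lawA5ShiftedGuard (b : ℕ → ℤ) (p M : ℕ) (T : List ℤ) : Bool :=
  decide (∀ x ∈ multipoleClasses b p, -(M : ℤ) ≤ classExp b p x) &&
    decide (∀ y < p, classPoleCount b p y = 1 → -(M : ℤ) + 1 ≤ classNu b p y) &&
    decide (∀ x ∈ multipoleClasses b p, classExp b p x = -(M : ℤ) → ¬ CentreIn b p x ∧ classTypeList b p x = T) &&
    decide (∀ y < p, 1 ≤ classPoleCount b p y → classNu b p y = -(M : ℤ) + 1 →
      isRaise T (classTypeList b p y) = true ∨ (¬ (2 : ℤ) ∣ b 0 ∧ CentreIn b p y ∧ classTypeList b p y = T)) &&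
    decide (∀ z < p, 1 ≤ classPoleCount b p z → classNu b p z = -(M : ℤ) + 2 → isRaise2 T (classTypeList b p z) = true) &&
    decide (∀ z < p, 1 ≤ classPoleCount b p z → classNu b p z = -(M : ℤ) + 3 →
      isRaiseN 3 T (classTypeList b p z) = true ∨ (¬ (2 : ℤ) ∣ b 0 ∧ CentreIn b p z ∧ isRaiseN 2 T (classTypeList b p z) = true)) &&
    decide (∀ x < p, 2 ≤ classPoleCount b p x → -(M : ℤ) + 2 ≤ classExp b p x) &&
    decide (∀ y < p, classPoleCount b p y = 1 → -(M : ℤ) + 2 ≤ classNu b p y)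

/-- Unpacking the guard. -/
theorem of_lawA5ShiftedGuard {b : ℕ → ℤ} {p M : ℕ} {T : List ℤ} (H : lawA5ShiftedGuard b p M T = true) :
    LawA4Classes b p M T ∧ ShapeClause b p M T ∧ (∀ x < p, 2 ≤ classPoleCount b p x → -(M : ℤ) + 2 ≤ classExp b p x) ∧
      (∀ y < p, classPoleCount b p y = 1 → -(M : ℤ) + 2 ≤ classNu b p y) := by
  simp only [lawA5ShiftedGuard, Bool.and_eq_true, decide_eq_true_eq] at H
  obtain ⟨⟨⟨⟨⟨⟨⟨h1, h2⟩, h3⟩, h4⟩, h5⟩, h6⟩, h7⟩, h8⟩ := H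
  exact ⟨⟨h1, fun y hy => h2 y hy, h3, fun y hy => h4 y hy, fun z hz => h5 z hz⟩, fun z hz => h6 z hz, h7, h8⟩

/-- **Licence**: both guards `= true` (for `b` and `b + e_j`) give `9 − 2M ≤ v_p(Cas_j(b))` under the frame / window / degree conditions
(THEOREM L5⁺ by name). -/
theorem lawA5_shifted_of_guard (b : ℕ → ℤ) (p j M : ℕ) (T : List ℤ) (hb : InPolytope b) (hb' : InPolytope (shift b j))
    (hj1 : 1 ≤ j) (hj7 : j ≤ 7) (hprime : p.Prime) (hp5 : 5 ≤ p) (hpb : (p : ℤ) ≤ b 0) (hwin : (b 0 + 2 : ℤ) < (p : ℤ) ^ 2)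
    (hM : 10 ≤ M) (hMe : Even M) (hT : T.reverse = T) (hdeg : (p : ℤ) * ((M : ℤ) - 4) ≤ 2 * dOf b + 1)
    (H : lawA5ShiftedGuard b p M T = true) (H' : lawA5ShiftedGuard (shift b j) p M T = true) (hcas : casoratian b j ≠ 0) :
    (9 : ℤ) - 2 * M ≤ padicValRat p (casoratian b j) := by
  haveI : Fact p.Prime := ⟨hprime⟩
  obtain ⟨hC, hS, hE2, hN2⟩ := of_lawA5ShiftedGuard H
  obtain ⟨hC', hS', hE2', hN2'⟩ := of_lawA5ShiftedGuard H'
  exact lawA5_shifted b j M T hb hb' ⟨hj1, hj7⟩ hp5 hpb hwin ⟨hM, hMe⟩ hT hC hC' hS hS' hdeg hE2 hN2 hE2' hN2' hcas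

/-! ## Sanity: one first-period cell reached by no landed rung (ATTEMPT-10 §7/§9) -/

/-- `b = (28; 12,10,8,7,7,4,3)`: ⌊d/11⌋ = 3; deep classes (−5,−3)/(−3,−5) at exponent −8 = double raises of `[−5,−5]`, layers −10, −9 empty. -/
def bShifted : ℕ → ℤ := fun i => (([28, 12, 10, 8, 7, 7, 4, 3] : List ℤ).getD i 0)

example : lawA5ShiftedGuard bShifted 11 10 [-5, -5] = true := by decide
example : lawA5ShiftedGuard (shift bShifted 7) 11 10 [-5, -5] = true := by decide

end Summit.KontsevichZagierPeriods.Zeta5Search.SecondOrder
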